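import Literature.NumberTheory.LFunctions.DirichletExplicitRegionGammaUniform
import Literature.NumberTheory.LFunctions.DirichletExplicitRegionMidHeightPole
import HarnessLib

/-!
# McCurley's explicit region: zeros of height `|γ| ≥ 1` (§4), PROVED

Topic `Literature/NumberTheory/LFunctions` (namespace `Literature.NumberTheory.LFunctions.McCurleyStechkin`),
continuing `DirichletExplicitRegionGammaUniform.lean` (Lemma 2 uniform in the height) and the `|γ| ≤ 1`
files. Everything here is PROVED (standard axioms); no definitions, NO named fact.

Source: K. S. McCurley, *Explicit zero-free regions for Dirichlet L-functions*, J. Number Theory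
**19** (1984) 7–32 [McCurley1984ZFR], **§4 "Proof of Theorem 1, the case |γ| ≥ 1"** ((28)–(37)):
with `σ = 1 + r/log M`, `M = max(k, k|γ|, 10)`, positivity (27) at the height `γ`, Lemma 3 for
`f(0,χ₀)`, Lemmas 5–6 with the Gamma terms of Lemma 2 (`≤ K log(m|γ|) + c`), Lemma 7 for principal
powers (pole terms `≤ (σ−1)/(m²γ²)`), and the corrections (36)–(37):
`a₁/(σ−β) ≤ a₀/(σ−1) + KA log(k|γ|) + C` with `C ≤ 0`, hence `β < 1 − 1/(R log M)` by (30).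
Our constants: Γ-terms `K log|t| − 0.33` (GammaUniform), Lemma 3 `0.80`, penalties `7.35`
(generic) / `1.07` (`χ²` induced) / `11.4` (real `χ`, with `0.321 log k` absorbed), so
`C = −9.5 / −16.8 / −4.4 / −5.0 / −15.6` in the five cases below.

## Main results (`χ` primitive mod `k`, `L ≥ log k + log|γ|`, `L ≥ log 10`, zero `ρ = β + iγ`, `|γ| ≥ 1`;
conclusion `β < 1 − 1/(R L)`, `R = 9.645908801`)

* `generic_large_height` (`χ², χ³, χ⁴ ≠ χ₀`), `order_three_large_height`, `order_four_large_height`,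
  `order_two_large_height`, and `zeta_large_height` (zeros of `ζ` with `|γ| ≥ 2`, `L ≥ log|γ|`).
* `height_ge_one`: the four character cases combined.

## References

* K. S. McCurley, J. Number Theory 19 (1984) 7–32, doi:10.1016/0022-314x(84)90089-1: §4 (28)–(37),
  Lemma 8 (ζ). [McCurley1984ZFR]
-/

noncomputable section

open Real Complex

namespace Literature.NumberTheory.LFunctions

namespace McCurleyStechkin

open Literature.Analysis.SpecialFunctions DirichletCharacter

/-! ## Bookkeeping -/

/-- `log 3 ≤ 1.0986124`. [folklore] -/
private theorem log_three_le_h : Real.log 3 ≤ 1.0986124 := by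
  rw [Real.log_le_iff_le_exp (by norm_num)]
  have h1 : Real.exp 1.0986124 = Real.exp 1 * Real.exp 0.0986124 := by rw [← Real.exp_add]; norm_num
  have h2 : (1.1036384 : ℝ) ≤ Real.exp 0.0986124 := by
    have h := Real.sum_le_exp_of_nonneg (x := (0.0986124 : ℝ)) (by norm_num) 6
    refine le_trans ?_ h
    simp only [Finset.sum_range_succ, Finset.sum_range_zero, Nat.factorial]
    norm_num
  rw [h1]
  have he := Real.exp_one_gt_d9
  nlinarith

/-- `1.609437 ≤ log 5`. [folklore] -/
private theorem log_five_ge_h : (1.609437 : ℝ) ≤ Real.log 5 := by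
  rw [Real.le_log_iff_exp_le (by norm_num)]
  have h1 : Real.exp 1.609437 = Real.exp 1 * Real.exp 0.609437 := by rw [← Real.exp_add]; norm_num
  have h2 : Real.exp 0.609437 ≤ 1.839396 := by
    have h := Real.exp_bound' (x := (0.609437 : ℝ)) (by norm_num) (by norm_num) (n := 7) (by norm_num)
    refine h.trans ?_
    simp only [Finset.sum_range_succ, Finset.sum_range_zero, Nat.factorial]
    norm_num
  rw [h1]
  have := Real.exp_one_lt_d9
  nlinarith [Real.exp_pos 0.609437]

/-- `log 10 ≥ 2.30258`. [folklore] -/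
private theorem log_ten_ge_h : (2.30258 : ℝ) ≤ Real.log 10 := by
  have h : Real.log 10 = Real.log 2 + Real.log 5 := by
    rw [show (10 : ℝ) = 2 * 5 by norm_num, Real.log_mul (by norm_num) (by norm_num)]
  rw [h]
  have h2 := Real.log_two_gt_d9
  have h5 := log_five_ge_h
  linarith

/-- `log|m t| = log m + log|t|` (`m > 0`, `t ≠ 0`). [folklore] -/
private theorem log_abs_mul {m t : ℝ} (hm : 0 < m) (ht : t ≠ 0) :
    Real.log |m * t| = Real.log m + Real.log |t| := by
  rw [abs_mul, abs_of_pos hm, Real.log_mul hm.ne' (abs_ne_zero.2 ht)]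

/-- The Gamma term at height `m·γ`, `|γ| ≥ 1`, `m ∈ {2,3,4}` written out: `≤ K log|γ| + K log m − 0.33`.
[cite: McCurley1984ZFR, Lemma 2] -/
private theorem gammaDiff_mul_le {a : ℕ} (ha : a ≤ 1) {σ : ℝ} (hσ : 1 < σ) (hσ' : σ ≤ 1.15)
    {γ : ℝ} (hγ : 1 ≤ |γ|) {m : ℝ} (hm : 1 ≤ m) :
    gammaDiff a σ (m * γ) ≤ bigK * Real.log |γ| + bigK * Real.log m - 0.33 := by
  have hγ0 : γ ≠ 0 := fun h ↦ by rw [h, abs_zero] at hγ; linarith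
  have h1 : 1 ≤ |m * γ| := by
    rw [abs_mul, abs_of_pos (by linarith)]; nlinarith [abs_nonneg γ]
  have h := gammaDiff_le_uniform ha hσ hσ' h1
  rw [log_abs_mul (by linarith) hγ0] at h
  linarith

/-- The pole term at height `m·γ`, `|γ| ≥ 1`: `(σ−1)/((σ−1)² + (mγ)²) ≤ (σ−1)/m²`. [cite: McCurley1984ZFR, §4 (31)] -/
private theorem pole_large {σ γ m : ℝ} (hσ : 1 < σ) (hγ : 1 ≤ |γ|) (hm : 0 < m) :
    (σ - 1) / ((σ - 1) ^ 2 + (m * γ) ^ 2) ≤ (σ - 1) / m ^ 2 := by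
  have hγ2 : 1 ≤ γ ^ 2 := by nlinarith [abs_nonneg γ, sq_abs γ]
  exact div_le_div_of_nonneg_left (by linarith) (by positivity) (by rw [mul_pow]; nlinarith [sq_nonneg (σ - 1)])

/-- Common bookkeeping: `σ = 1 + r/L` with `r = rOpt`, `L ≥ log 10`, and the window. [cite: McCurley1984ZFR, §4] -/
private theorem setup_h {L : ℝ} (hL10 : Real.log 10 ≤ L) {β : ℝ} (hβ : 1 - 1 / (9.645908801 * L) ≤ β) :
    0 < L ∧ 2.30258 ≤ L ∧ 1 < 1 + rOpt / L ∧ 1 + rOpt / L ≤ 1.15 ∧ 0 < β ∧ β ≠ 1 / 2 ∧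
      1 - (1 / 9.645908801) / L ≤ β ∧ 1 + rOpt / L - 1 = rOpt / L := by
  have hL : 2.30258 ≤ L := log_ten_ge_h.trans hL10
  have hL0 : 0 < L := by linarith
  have hr : (0 : ℝ) < rOpt := by norm_num [rOpt]
  have hb : 1 - (1 / 9.645908801) / L ≤ β := by
    have e : 1 / (9.645908801 * L) = (1 / 9.645908801) / L := by rw [div_div]
    rw [← e]; exact hβ
  have hbL : (1 / 9.645908801) / L ≤ 0.0451 := by
    rw [div_le_iff₀ hL0]; norm_num; linarith
  refine ⟨hL0, hL, by have := div_pos hr hL0; linarith, ?_, by linarith, ?_, hb, by ring⟩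
  · have : rOpt / L ≤ 0.15 := by rw [div_le_iff₀ hL0]; norm_num [rOpt]; linarith
    linarith
  · intro h; rw [h] at hb; linarith

/-- `s_k(σ) ≥ 0`. [cite: McCurley1984ZFR, §2] -/
private theorem sum_help_nonneg_h (k : ℕ) {σ : ℝ} (hσ : 1 < σ) :
    0 ≤ ∑ p ∈ k.primeFactors, (uCorr p σ - kappa * uCorr p (sigmaOne σ)) :=
  Finset.sum_nonneg fun _ hp ↦ help_nonneg (Nat.prime_of_mem_primeFactors hp).two_le hσ

/-- `Σ_{p∣k} T(p,σ) = (a₂+a₃+a₄)Σ max(G,0) − a₀ Σ help`. [cite: McCurley1984ZFR, §4 (36)] -/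
private theorem sum_tPen_eq_h (k : ℕ) (σ : ℝ) :
    ∑ p ∈ k.primeFactors, tPen p σ =
      rsA234 * ∑ p ∈ k.primeFactors, max (gPen p σ) 0
        - rsA0 * ∑ p ∈ k.primeFactors, (uCorr p σ - kappa * uCorr p (sigmaOne σ)) := by
  simp only [tPen]
  rw [Finset.sum_sub_distrib, ← Finset.mul_sum, ← Finset.mul_sum]

/-- `Σ_{p∣k} log p ≤ log k` (`k ≠ 0`). [folklore] -/
private theorem sum_log_primeFactors_le_h {k : ℕ} (hk : k ≠ 0) :
    ∑ p ∈ k.primeFactors, Real.log p ≤ Real.log k := by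
  have hdvd := Nat.prod_primeFactors_dvd k
  have hle : ((∏ p ∈ k.primeFactors, p : ℕ) : ℝ) ≤ k := by exact_mod_cast Nat.le_of_dvd (Nat.pos_of_ne_zero hk) hdvd
  have hpos : (0 : ℝ) < ((∏ p ∈ k.primeFactors, p : ℕ) : ℝ) := by
    rw [Nat.cast_prod]
    exact Finset.prod_pos fun p hp ↦ by exact_mod_cast (Nat.prime_of_mem_primeFactors hp).pos
  rw [← Real.log_prod (fun p hp ↦ by exact_mod_cast (Nat.prime_of_mem_primeFactors hp).ne_zero),
    ← Nat.cast_prod]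
  exact Real.log_le_log hpos hle

section Clauses

variable {k : ℕ} [NeZero k] {χ : DirichletCharacter ℂ k}

omit [NeZero k] in
/-- `χ⁻¹` is primitive when `χ` is. [cite: MontgomeryVaughan2007, §10.1 p. 334] -/
private theorem isPrimitive_inv_h (hχ : χ.IsPrimitive) : χ⁻¹.IsPrimitive := by
  rw [DirichletCharacter.isPrimitive_def, DirichletCharacter.conductor_inv]; exact hχ

/-- The numeric log facts used in every case: `K log 2 ≤ 0.1916`, `K log 3 ≤ 0.3037`, `K log 4 ≤ 0.3832`.
[folklore] -/
private theorem klog_bounds : bigK * Real.log 2 ≤ 0.1916 ∧ bigK * Real.log 3 ≤ 0.3037 ∧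
    bigK * Real.log 4 ≤ 0.3832 := by
  have hK := bigK_lt
  have hK0 := bigK_pos
  have l2 := Real.log_two_lt_d9
  have l3 := log_three_le_h
  have l4 : Real.log 4 = 2 * Real.log 2 := by
    rw [show (4 : ℝ) = 2 ^ 2 by norm_num, Real.log_pow]; push_cast; ring
  refine ⟨?_, ?_, ?_⟩
  · nlinarith [Real.log_two_gt_d9]
  · nlinarith [show (0:ℝ) ≤ Real.log 3 from Real.log_nonneg (by norm_num)]
  · rw [l4]; nlinarith [Real.log_two_gt_d9]

set_option maxHeartbeats 800000 in
/-- **§4, characters of order `≥ 5` (`χ², χ³, χ⁴ ≠ χ₀`), `|γ| ≥ 1`.** [cite: McCurley1984ZFR, §4 (28)–(30), (35)–(37)] -/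
theorem generic_large_height (hχ : χ.IsPrimitive) (h2 : χ ^ 2 ≠ 1) (h3 : χ ^ 3 ≠ 1) (h4 : χ ^ 4 ≠ 1)
    {ρ : ℂ} {L : ℝ} (hLk : Real.log k + Real.log |ρ.im| ≤ L) (hL10 : Real.log 10 ≤ L)
    (hz : χ.LFunction ρ = 0) (hγ : 1 ≤ |ρ.im|) :
    ρ.re < 1 - 1 / (9.645908801 * L) := by
  by_contra hcon
  have hβw := not_lt.1 hcon
  have h1 : χ ≠ 1 := fun h ↦ h2 (by rw [h, one_pow])
  obtain ⟨hL0, hL, hσ, hσ', hβ0, hβh, hβ', hσm1⟩ := setup_h hL10 hβw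
  set σ := 1 + rOpt / L with hσdef
  have hr : (0 : ℝ) < rOpt := by norm_num [rOpt]
  have hlogγ : 0 ≤ Real.log |ρ.im| := Real.log_nonneg hγ
  have hlogk : 0 ≤ Real.log k := Real.log_natCast_nonneg k
  have hP := rosser_positivity_complex χ hσ ρ.im
  have hζ := fdiff_principal_le_sharp115 (k := k) hσ hσ'
  have hm1 := DirichletTheta.fAt_le_of_zero_im hχ h1 hσ.le hz hβ0 hβh
  have hm2 := fAt_induced_le (χ ^ 2) h2 hσ (2 * ρ.im)
  have hm3 := fAt_induced_le (χ ^ 3) h3 hσ (3 * ρ.im)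
  have hm4 := fAt_induced_le (χ ^ 4) h4 hσ (4 * ρ.im)
  have hΓ1 := gammaDiff_le_uniform (charParity_le_one χ) hσ hσ' hγ
  have hΓ2 := gammaDiff_mul_le (charParity_le_one (χ ^ 2)) hσ hσ' hγ (m := 2) (by norm_num)
  have hΓ3 := gammaDiff_mul_le (charParity_le_one (χ ^ 3)) hσ hσ' hγ (m := 3) (by norm_num)
  have hΓ4 := gammaDiff_mul_le (charParity_le_one (χ ^ 4)) hσ hσ' hγ (m := 4) (by norm_num)
  obtain ⟨kl2, kl3, kl4⟩ := klog_bounds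
  have hT := sum_tPen_le_sharp k hσ
  rw [sum_tPen_eq_h, rsA234] at hT
  have hKpos := bigK_pos
  have hKL : bigK * (Real.log k + Real.log |ρ.im|) ≤ bigK * L := mul_le_mul_of_nonneg_left hLk hKpos.le
  have a0 : (0 : ℝ) ≤ rsA0 := by norm_num [rsA0]
  have a1 : (0 : ℝ) ≤ rsA1 := by norm_num [rsA1]
  have a2 : (0 : ℝ) ≤ rsA2 := by norm_num [rsA2]
  have a3 : (0 : ℝ) ≤ rsA3 := by norm_num [rsA3]
  have a4 : (0 : ℝ) ≤ rsA4 := by norm_num [rsA4]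
  have e0 := mul_le_mul_of_nonneg_left hζ a0
  have e1 := mul_le_mul_of_nonneg_left (show fAt χ σ ρ.im ≤ bigK * L - 0.33 - 1 / (σ - ρ.re) by
    linarith) a1
  have e2 := mul_le_mul_of_nonneg_left (show fAt (χ ^ 2) σ (2 * ρ.im) ≤
    bigK * L + 0.1916 - 0.33 + ∑ p ∈ k.primeFactors, max (gPen p σ) 0 by linarith) a2
  have e3 := mul_le_mul_of_nonneg_left (show fAt (χ ^ 3) σ (3 * ρ.im) ≤
    bigK * L + 0.3037 - 0.33 + ∑ p ∈ k.primeFactors, max (gPen p σ) 0 by linarith) a3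
  have e4 := mul_le_mul_of_nonneg_left (show fAt (χ ^ 4) σ (4 * ρ.im) ≤
    bigK * L + 0.3832 - 0.33 + ∑ p ∈ k.primeFactors, max (gPen p σ) 0 by linarith) a4
  have hc : (7.35 : ℝ) - 0.80 * rsA0 - 0.33 * rsA1 + (0.1916 - 0.33) * rsA2 + (0.3037 - 0.33) * rsA3
      + (0.3832 - 0.33) * rsA4 ≤ -9.5 := by
    norm_num [rsA0, rsA1, rsA2, rsA3, rsA4]
  have key : rsA1 * (1 / (σ - ρ.re)) ≤ rsA0 * (1 / (σ - 1))
      + bigK * (rsA1 + rsA2 + rsA3 + rsA4) * L - 9.5 := by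
    linarith [e0, e1, e2, e3, e4, hP, hT, hc]
  have hm : rsA1 / (σ - ρ.re) ≤ rsA0 / (σ - 1) + bigK * (rsA1 + rsA2 + rsA3 + rsA4) * L - 9.5 := by
    simpa only [mul_one_div] using key
  have hβ1 : ρ.re < 1 := by
    by_contra hb
    exact LFunction_ne_zero_of_one_le_re χ (Or.inl h1) (not_lt.1 hb) hz
  have hc1 : (0 : ℝ) < rsA1 := by norm_num [rsA1]
  refine endgame_contra (K' := bigK * (rsA1 + rsA2 + rsA3 + rsA4)) (C := -9.5) hL0 hr (by norm_num) hc1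
    (by norm_num) hβ' (by linarith) ?_ numeric_generic
  linarith

set_option maxHeartbeats 800000 in
/-- **§4, cubic characters, `|γ| ≥ 1`** (`χ² = χ̄`, `χ⁴ = χ` primitive; `χ³ = χ₀` principal with pole term
`≤ (σ−1)/9` and `a₃T(k,1) − a₀s(k) ≤ 0`). [cite: McCurley1984ZFR, §4 (33) and (28)–(30)] -/
theorem order_three_large_height (hχ : χ.IsPrimitive) (h1 : χ ≠ 1) (h3 : χ ^ 3 = 1) {ρ : ℂ} {L : ℝ}
    (hLk : Real.log k + Real.log |ρ.im| ≤ L) (hL10 : Real.log 10 ≤ L)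
    (hz : χ.LFunction ρ = 0) (hγ : 1 ≤ |ρ.im|) :
    ρ.re < 1 - 1 / (9.645908801 * L) := by
  by_contra hcon
  have hβw := not_lt.1 hcon
  obtain ⟨hL0, hL, hσ, hσ', hβ0, hβh, hβ', hσm1⟩ := setup_h hL10 hβw
  set σ := 1 + rOpt / L with hσdef
  have hr : (0 : ℝ) < rOpt := by norm_num [rOpt]
  have hlogγ : 0 ≤ Real.log |ρ.im| := Real.log_nonneg hγ
  have hlogk : 0 ≤ Real.log k := Real.log_natCast_nonneg k
  have hinv : χ ^ 2 = χ⁻¹ := by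
    have : χ ^ 2 * χ = 1 := by rw [← pow_succ]; exact h3
    exact eq_inv_of_mul_eq_one_left this
  have h4 : χ ^ 4 = χ := by rw [pow_succ, h3, one_mul]
  have hP := rosser_positivity_complex χ hσ ρ.im
  rw [hinv, h3, h4] at hP
  have hζ := fdiff_principal_le_sharp115 (k := k) hσ hσ'
  have hm1 := DirichletTheta.fAt_le_of_zero_im hχ h1 hσ.le hz hβ0 hβh
  have hm2 := DirichletTheta.fAt_le (isPrimitive_inv_h hχ) (inv_ne_one.2 h1) hσ.le (2 * ρ.im)
  rw [DirichletTheta.charParity_inv] at hm2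
  have hm3 := fAt_principal_le_uniform k hσ hσ' (t := 3 * ρ.im)
    (by rw [abs_mul, abs_of_pos (by norm_num : (0:ℝ) < 3)]; linarith)
  have hm4 := DirichletTheta.fAt_le hχ h1 hσ.le (4 * ρ.im)
  have hΓ1 := gammaDiff_le_uniform (charParity_le_one χ) hσ hσ' hγ
  have hΓ2 := gammaDiff_mul_le (charParity_le_one χ) hσ hσ' hγ (m := 2) (by norm_num)
  have hΓ4 := gammaDiff_mul_le (charParity_le_one χ) hσ hσ' hγ (m := 4) (by norm_num)
  have hγ0 : ρ.im ≠ 0 := fun h ↦ by rw [h, abs_zero] at hγ; linarith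
  have hl3 : Real.log |3 * ρ.im| = Real.log 3 + Real.log |ρ.im| := log_abs_mul (by norm_num) hγ0
  rw [hl3] at hm3
  have hpole := pole_large (m := 3) hσ hγ (by norm_num)
  have hpole' : (σ - 1) / (3 : ℝ) ^ 2 ≤ 0.0167 := by
    rw [hσm1]; rw [div_le_iff₀ (by norm_num)]
    have : rOpt / L ≤ 0.15 := by rw [div_le_iff₀ hL0]; norm_num [rOpt]; linarith
    linarith
  obtain ⟨kl2, kl3, kl4⟩ := klog_bounds
  -- corrections `a₃(U+κU₁) − a₀(U−κU₁) ≤ 0`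
  have hcorr : rsA3 * ∑ p ∈ k.primeFactors, (uCorr p σ + kappa * uCorr p (sigmaOne σ))
      - rsA0 * ∑ p ∈ k.primeFactors, (uCorr p σ - kappa * uCorr p (sigmaOne σ)) ≤ 0 := by
    rw [Finset.mul_sum, Finset.mul_sum, ← Finset.sum_sub_distrib]
    refine Finset.sum_nonpos fun p hp ↦ ?_
    have hp2 := (Nat.prime_of_mem_primeFactors hp).two_le
    have hU1 := uCorr_sigmaOne_le_div_sqrt_two hp2 hσ.le
    have hU0 : 0 ≤ uCorr p σ := uCorr_nonneg hp2 (by linarith)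
    have hU10 : 0 ≤ uCorr p (sigmaOne σ) := uCorr_nonneg hp2 (by linarith [one_lt_sigmaOne hσ.le])
    have hs : (1.41421 : ℝ) < Real.sqrt 2 := by
      rw [show (1.41421 : ℝ) = Real.sqrt (1.41421 ^ 2) by rw [Real.sqrt_sq (by norm_num)]]
      exact Real.sqrt_lt_sqrt (by norm_num) (by norm_num)
    have hU1' : uCorr p (sigmaOne σ) * 1.41421 ≤ uCorr p σ := by
      have h := (le_div_iff₀ (by linarith : (0:ℝ) < Real.sqrt 2)).1 hU1
      nlinarith
    have hk := kappa_lt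
    simp only [rsA3, rsA0]
    nlinarith [mul_le_mul_of_nonneg_right hk.le hU10]
  have hKpos := bigK_pos
  have hKL : bigK * (Real.log k + Real.log |ρ.im|) ≤ bigK * L := mul_le_mul_of_nonneg_left hLk hKpos.le
  have hKk : 0 ≤ bigK * Real.log k := mul_nonneg hKpos.le hlogk
  have a0 : (0 : ℝ) ≤ rsA0 := by norm_num [rsA0]
  have a1 : (0 : ℝ) ≤ rsA1 := by norm_num [rsA1]
  have a2 : (0 : ℝ) ≤ rsA2 := by norm_num [rsA2]
  have a3 : (0 : ℝ) ≤ rsA3 := by norm_num [rsA3]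
  have a4 : (0 : ℝ) ≤ rsA4 := by norm_num [rsA4]
  have e0 := mul_le_mul_of_nonneg_left hζ a0
  have e1 := mul_le_mul_of_nonneg_left (show fAt χ σ ρ.im ≤ bigK * L - 0.33 - 1 / (σ - ρ.re) by
    linarith) a1
  have e2 := mul_le_mul_of_nonneg_left (show fAt χ⁻¹ σ (2 * ρ.im) ≤ bigK * L + 0.1916 - 0.33 by
    linarith) a2
  have e3 := mul_le_mul_of_nonneg_left (show fAt (1 : DirichletCharacter ℂ k) σ (3 * ρ.im) ≤
    bigK * L + 0.0167 + 0.3037 - 0.33 + ∑ p ∈ k.primeFactors, (uCorr p σ + kappa * uCorr p (sigmaOne σ)) by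
    linarith) a3
  have e4 := mul_le_mul_of_nonneg_left (show fAt χ σ (4 * ρ.im) ≤ bigK * L + 0.3832 - 0.33 by linarith) a4
  have hc : -(0.80 : ℝ) * rsA0 - 0.33 * rsA1 + (0.1916 - 0.33) * rsA2 + (0.0167 + 0.3037 - 0.33) * rsA3
      + (0.3832 - 0.33) * rsA4 ≤ -16.8 := by
    norm_num [rsA0, rsA1, rsA2, rsA3, rsA4]
  have key : rsA1 * (1 / (σ - ρ.re)) ≤ rsA0 * (1 / (σ - 1))
      + bigK * (rsA1 + rsA2 + rsA3 + rsA4) * L - 16.8 := by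
    linarith [e0, e1, e2, e3, e4, hP, hcorr, hc]
  have hm : rsA1 / (σ - ρ.re) ≤ rsA0 / (σ - 1) + bigK * (rsA1 + rsA2 + rsA3 + rsA4) * L - 16.8 := by
    simpa only [mul_one_div] using key
  have hβ1 : ρ.re < 1 := by
    by_contra hb
    exact LFunction_ne_zero_of_one_le_re χ (Or.inl h1) (not_lt.1 hb) hz
  have hc1 : (0 : ℝ) < rsA1 := by norm_num [rsA1]
  refine endgame_contra (K' := bigK * (rsA1 + rsA2 + rsA3 + rsA4)) (C := -16.8) hL0 hr (by norm_num) hc1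
    (by norm_num) hβ' (by linarith) ?_ numeric_generic
  linarith

set_option maxHeartbeats 800000 in
/-- **§4, quartic characters, `|γ| ≥ 1`** (`χ³ = χ̄` primitive, `χ²` real possibly imprimitive,
`χ⁴ = χ₀` principal with pole term `≤ (σ−1)/16` and `a₄T(k,1) − a₀s(k) ≤ 0`). [cite: McCurley1984ZFR, §4 (34) and (28)–(30)] -/
theorem order_four_large_height (hχ : χ.IsPrimitive) (h2 : χ ^ 2 ≠ 1) (h4 : χ ^ 4 = 1) {ρ : ℂ} {L : ℝ}
    (hLk : Real.log k + Real.log |ρ.im| ≤ L) (hL10 : Real.log 10 ≤ L)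
    (hz : χ.LFunction ρ = 0) (hγ : 1 ≤ |ρ.im|) :
    ρ.re < 1 - 1 / (9.645908801 * L) := by
  by_contra hcon
  have hβw := not_lt.1 hcon
  have h1 : χ ≠ 1 := fun h ↦ h2 (by rw [h, one_pow])
  obtain ⟨hL0, hL, hσ, hσ', hβ0, hβh, hβ', hσm1⟩ := setup_h hL10 hβw
  set σ := 1 + rOpt / L with hσdef
  have hr : (0 : ℝ) < rOpt := by norm_num [rOpt]
  have hlogγ : 0 ≤ Real.log |ρ.im| := Real.log_nonneg hγ
  have hlogk : 0 ≤ Real.log k := Real.log_natCast_nonneg k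
  have hinv : χ ^ 3 = χ⁻¹ := by
    have : χ ^ 3 * χ = 1 := by rw [← pow_succ]; exact h4
    exact eq_inv_of_mul_eq_one_left this
  have hP := rosser_positivity_complex χ hσ ρ.im
  rw [hinv, h4] at hP
  have hζ := fdiff_principal_le_sharp115 (k := k) hσ hσ'
  have hm1 := DirichletTheta.fAt_le_of_zero_im hχ h1 hσ.le hz hβ0 hβh
  have hm2 := fAt_induced_le (χ ^ 2) h2 hσ (2 * ρ.im)
  have hG := sum_max_gPen_le k hσ
  have hm3 := DirichletTheta.fAt_le (isPrimitive_inv_h hχ) (inv_ne_one.2 h1) hσ.le (3 * ρ.im)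
  rw [DirichletTheta.charParity_inv] at hm3
  have hm4 := fAt_principal_le_uniform k hσ hσ' (t := 4 * ρ.im)
    (by rw [abs_mul, abs_of_pos (by norm_num : (0:ℝ) < 4)]; linarith)
  have hΓ1 := gammaDiff_le_uniform (charParity_le_one χ) hσ hσ' hγ
  have hΓ2 := gammaDiff_mul_le (charParity_le_one (χ ^ 2)) hσ hσ' hγ (m := 2) (by norm_num)
  have hΓ3 := gammaDiff_mul_le (charParity_le_one χ) hσ hσ' hγ (m := 3) (by norm_num)
  have hγ0 : ρ.im ≠ 0 := fun h ↦ by rw [h, abs_zero] at hγ; linarith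
  have hl4 : Real.log |4 * ρ.im| = Real.log 4 + Real.log |ρ.im| := log_abs_mul (by norm_num) hγ0
  rw [hl4] at hm4
  have hpole := pole_large (m := 4) hσ hγ (by norm_num)
  have hpole' : (σ - 1) / (4 : ℝ) ^ 2 ≤ 0.0094 := by
    rw [hσm1]; rw [div_le_iff₀ (by norm_num)]
    have : rOpt / L ≤ 0.15 := by rw [div_le_iff₀ hL0]; norm_num [rOpt]; linarith
    linarith
  obtain ⟨kl2, kl3, kl4⟩ := klog_bounds
  have hcorr : rsA4 * ∑ p ∈ k.primeFactors, (uCorr p σ + kappa * uCorr p (sigmaOne σ))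
      - rsA0 * ∑ p ∈ k.primeFactors, (uCorr p σ - kappa * uCorr p (sigmaOne σ)) ≤ 0 := by
    rw [Finset.mul_sum, Finset.mul_sum, ← Finset.sum_sub_distrib]
    refine Finset.sum_nonpos fun p hp ↦ ?_
    have hp2 := (Nat.prime_of_mem_primeFactors hp).two_le
    have hU1 : uCorr p (sigmaOne σ) ≤ uCorr p σ :=
      uCorr_anti hp2 (by linarith) (lt_sigmaOne (show (0:ℝ) < σ by linarith)).le
    have hU10 : 0 ≤ uCorr p (sigmaOne σ) := uCorr_nonneg hp2 (by linarith [one_lt_sigmaOne hσ.le])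
    have hU0 : 0 ≤ uCorr p σ := uCorr_nonneg hp2 (by linarith)
    have hk1 : kappa * uCorr p (sigmaOne σ) ≤ kappa * uCorr p σ :=
      mul_le_mul_of_nonneg_left hU1 kappa_pos.le
    have hk2 : kappa * uCorr p σ ≤ 0.44723 * uCorr p σ :=
      mul_le_mul_of_nonneg_right kappa_lt.le hU0
    have hk3 : 0 ≤ kappa * uCorr p (sigmaOne σ) := mul_nonneg kappa_pos.le hU10
    simp only [rsA4, rsA0]
    linarith
  have hKpos := bigK_pos
  have hKL : bigK * (Real.log k + Real.log |ρ.im|) ≤ bigK * L := mul_le_mul_of_nonneg_left hLk hKpos.le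
  have hKk : 0 ≤ bigK * Real.log k := mul_nonneg hKpos.le hlogk
  have a0 : (0 : ℝ) ≤ rsA0 := by norm_num [rsA0]
  have a1 : (0 : ℝ) ≤ rsA1 := by norm_num [rsA1]
  have a2 : (0 : ℝ) ≤ rsA2 := by norm_num [rsA2]
  have a3 : (0 : ℝ) ≤ rsA3 := by norm_num [rsA3]
  have a4 : (0 : ℝ) ≤ rsA4 := by norm_num [rsA4]
  have e0 := mul_le_mul_of_nonneg_left hζ a0
  have e1 := mul_le_mul_of_nonneg_left (show fAt χ σ ρ.im ≤ bigK * L - 0.33 - 1 / (σ - ρ.re) by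
    linarith) a1
  have e2 := mul_le_mul_of_nonneg_left (show fAt (χ ^ 2) σ (2 * ρ.im) ≤ bigK * L + 0.1916 - 0.33 + 1.07 by
    linarith) a2
  have e3 := mul_le_mul_of_nonneg_left (show fAt χ⁻¹ σ (3 * ρ.im) ≤ bigK * L + 0.3037 - 0.33 by linarith) a3
  have e4 := mul_le_mul_of_nonneg_left (show fAt (1 : DirichletCharacter ℂ k) σ (4 * ρ.im) ≤
    bigK * L + 0.0094 + 0.3832 - 0.33 + ∑ p ∈ k.primeFactors, (uCorr p σ + kappa * uCorr p (sigmaOne σ)) by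
    linarith) a4
  have hc : -(0.80 : ℝ) * rsA0 - 0.33 * rsA1 + (0.1916 - 0.33 + 1.07) * rsA2 + (0.3037 - 0.33) * rsA3
      + (0.0094 + 0.3832 - 0.33) * rsA4 ≤ -4.4 := by
    norm_num [rsA0, rsA1, rsA2, rsA3, rsA4]
  have key : rsA1 * (1 / (σ - ρ.re)) ≤ rsA0 * (1 / (σ - 1))
      + bigK * (rsA1 + rsA2 + rsA3 + rsA4) * L - 4.4 := by
    linarith [e0, e1, e2, e3, e4, hP, hcorr, hc]
  have hm : rsA1 / (σ - ρ.re) ≤ rsA0 / (σ - 1) + bigK * (rsA1 + rsA2 + rsA3 + rsA4) * L - 4.4 := by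
    simpa only [mul_one_div] using key
  have hβ1 : ρ.re < 1 := by
    by_contra hb
    exact LFunction_ne_zero_of_one_le_re χ (Or.inl h1) (not_lt.1 hb) hz
  have hc1 : (0 : ℝ) < rsA1 := by norm_num [rsA1]
  refine endgame_contra (K' := bigK * (rsA1 + rsA2 + rsA3 + rsA4)) (C := -4.4) hL0 hr (by norm_num) hc1
    (by norm_num) hβ' (by linarith) ?_ numeric_generic
  linarith

set_option maxHeartbeats 800000 in
/-- **§4, real characters, `|γ| ≥ 1`** (`χ³ = χ`; `χ² = χ⁴ = χ₀` principal with pole terms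
`≤ (σ−1)/4, (σ−1)/16`; the principal corrections absorbed by `0.321 log k ≤ (a₂+a₄)K log k`, cf. (31)–(32)).
[cite: McCurley1984ZFR, §4 (31)–(32) and (28)–(30)] -/
theorem order_two_large_height (hχ : χ.IsPrimitive) (h1 : χ ≠ 1) (h2 : χ ^ 2 = 1) {ρ : ℂ} {L : ℝ}
    (hLk : Real.log k + Real.log |ρ.im| ≤ L) (hL10 : Real.log 10 ≤ L)
    (hz : χ.LFunction ρ = 0) (hγ : 1 ≤ |ρ.im|) :
    ρ.re < 1 - 1 / (9.645908801 * L) := by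
  by_contra hcon
  have hβw := not_lt.1 hcon
  obtain ⟨hL0, hL, hσ, hσ', hβ0, hβh, hβ', hσm1⟩ := setup_h hL10 hβw
  set σ := 1 + rOpt / L with hσdef
  have hr : (0 : ℝ) < rOpt := by norm_num [rOpt]
  have hlogγ : 0 ≤ Real.log |ρ.im| := Real.log_nonneg hγ
  have hlogk : 0 ≤ Real.log k := Real.log_natCast_nonneg k
  have h3 : χ ^ 3 = χ := by rw [pow_succ, h2, one_mul]
  have h4 : χ ^ 4 = 1 := by rw [show 4 = 2 * 2 by norm_num, pow_mul, h2, one_pow]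
  have hP := rosser_positivity_complex χ hσ ρ.im
  rw [h2, h3, h4] at hP
  have hζ := fdiff_principal_le_sharp115 (k := k) hσ hσ'
  have hm1 := DirichletTheta.fAt_le_of_zero_im hχ h1 hσ.le hz hβ0 hβh
  have hm2 := fAt_principal_le_uniform k hσ hσ' (t := 2 * ρ.im) (by rw [abs_mul, abs_two]; linarith)
  have hm3 := DirichletTheta.fAt_le hχ h1 hσ.le (3 * ρ.im)
  have hm4 := fAt_principal_le_uniform k hσ hσ' (t := 4 * ρ.im)
    (by rw [abs_mul, abs_of_pos (by norm_num : (0:ℝ) < 4)]; linarith)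
  have hΓ1 := gammaDiff_le_uniform (charParity_le_one χ) hσ hσ' hγ
  have hΓ3 := gammaDiff_mul_le (charParity_le_one χ) hσ hσ' hγ (m := 3) (by norm_num)
  have hγ0 : ρ.im ≠ 0 := fun h ↦ by rw [h, abs_zero] at hγ; linarith
  have hl2 : Real.log |2 * ρ.im| = Real.log 2 + Real.log |ρ.im| := log_abs_mul (by norm_num) hγ0
  have hl4 : Real.log |4 * ρ.im| = Real.log 4 + Real.log |ρ.im| := log_abs_mul (by norm_num) hγ0
  rw [hl2] at hm2
  rw [hl4] at hm4
  have hpole2 := pole_large (m := 2) hσ hγ (by norm_num)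
  have hpole4 := pole_large (m := 4) hσ hγ (by norm_num)
  have hrL : rOpt / L ≤ 0.15 := by rw [div_le_iff₀ hL0]; norm_num [rOpt]; linarith
  have hpole2' : (σ - 1) / (2 : ℝ) ^ 2 ≤ 0.0375 := by
    rw [hσm1]; rw [div_le_iff₀ (by norm_num)]; linarith
  have hpole4' : (σ - 1) / (4 : ℝ) ^ 2 ≤ 0.0094 := by
    rw [hσm1]; rw [div_le_iff₀ (by norm_num)]; linarith
  obtain ⟨kl2, kl3, kl4⟩ := klog_bounds
  -- `0.321 Σ_{p∣k} log p ≤ 0.321 log k ≤ (a₂+a₄) K log k`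
  have hlogsum : ∑ p ∈ k.primeFactors, Real.log p ≤ Real.log k :=
    sum_log_primeFactors_le_h (NeZero.ne k)
  have hpen := sum_orderTwoPen_le k hσ
  rw [Finset.sum_sub_distrib, Finset.sum_sub_distrib, ← Finset.mul_sum, ← Finset.mul_sum,
    ← Finset.mul_sum] at hpen
  have hspare : 0.321 * Real.log k ≤ (rsA2 + rsA4) * (bigK * Real.log k) := by
    have hK := bigK_gt
    have : (0.321 : ℝ) ≤ (rsA2 + rsA4) * bigK := by norm_num [rsA2, rsA4]; nlinarith
    nlinarith
  have hKpos := bigK_pos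
  have hKL : bigK * (Real.log k + Real.log |ρ.im|) ≤ bigK * L := mul_le_mul_of_nonneg_left hLk hKpos.le
  have a0 : (0 : ℝ) ≤ rsA0 := by norm_num [rsA0]
  have a1 : (0 : ℝ) ≤ rsA1 := by norm_num [rsA1]
  have a2 : (0 : ℝ) ≤ rsA2 := by norm_num [rsA2]
  have a3 : (0 : ℝ) ≤ rsA3 := by norm_num [rsA3]
  have a4 : (0 : ℝ) ≤ rsA4 := by norm_num [rsA4]
  have e0 := mul_le_mul_of_nonneg_left hζ a0
  have e1 := mul_le_mul_of_nonneg_left (show fAt χ σ ρ.im ≤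
    bigK * Real.log k + bigK * Real.log |ρ.im| - 0.33 - 1 / (σ - ρ.re) by linarith) a1
  have e2 := mul_le_mul_of_nonneg_left (show fAt (1 : DirichletCharacter ℂ k) σ (2 * ρ.im) ≤
    0.0375 + bigK * Real.log |ρ.im| + 0.1916 - 0.33
      + ∑ p ∈ k.primeFactors, (uCorr p σ + kappa * uCorr p (sigmaOne σ)) by linarith) a2
  have e3 := mul_le_mul_of_nonneg_left (show fAt χ σ (3 * ρ.im) ≤
    bigK * Real.log k + bigK * Real.log |ρ.im| + 0.3037 - 0.33 by linarith) a3
  have e4 := mul_le_mul_of_nonneg_left (show fAt (1 : DirichletCharacter ℂ k) σ (4 * ρ.im) ≤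
    0.0094 + bigK * Real.log |ρ.im| + 0.3832 - 0.33
      + ∑ p ∈ k.primeFactors, (uCorr p σ + kappa * uCorr p (sigmaOne σ)) by linarith) a4
  have hc : -(0.80 : ℝ) * rsA0 - 0.33 * rsA1 + (0.0375 + 0.1916 - 0.33) * rsA2 + (0.3037 - 0.33) * rsA3
      + (0.0094 + 0.3832 - 0.33) * rsA4 + 11.4 ≤ -5.0 := by
    norm_num [rsA0, rsA1, rsA2, rsA3, rsA4]
  have key : rsA1 * (1 / (σ - ρ.re)) ≤ rsA0 * (1 / (σ - 1))
      + bigK * (rsA1 + rsA2 + rsA3 + rsA4) * L - 5.0 := by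
    nlinarith [e0, e1, e2, e3, e4, hP, hpen, hlogsum, hspare, hc, hKL, mul_nonneg a1 hKpos.le,
      mul_nonneg a3 hKpos.le]
  have hm : rsA1 / (σ - ρ.re) ≤ rsA0 / (σ - 1) + bigK * (rsA1 + rsA2 + rsA3 + rsA4) * L - 5.0 := by
    simpa only [mul_one_div] using key
  have hβ1 : ρ.re < 1 := by
    by_contra hb
    exact LFunction_ne_zero_of_one_le_re χ (Or.inl h1) (not_lt.1 hb) hz
  have hc1 : (0 : ℝ) < rsA1 := by norm_num [rsA1]
  refine endgame_contra (K' := bigK * (rsA1 + rsA2 + rsA3 + rsA4)) (C := -5.0) hL0 hr (by norm_num) hc1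
    (by norm_num) hβ' (by linarith) ?_ numeric_generic
  linarith

/-- **All four character cases, `|γ| ≥ 1`:** for `χ` primitive mod `k`, `χ ≠ χ₀`, `L ≥ log k + log|γ|`,
`L ≥ log 10`, every zero `β + iγ` with `|γ| ≥ 1` has `β < 1 − 1/(R L)`. [cite: McCurley1984ZFR, §4 and Theorem 1] -/
theorem height_ge_one (hχ : χ.IsPrimitive) (h1 : χ ≠ 1) {ρ : ℂ} {L : ℝ}
    (hLk : Real.log k + Real.log |ρ.im| ≤ L) (hL10 : Real.log 10 ≤ L)
    (hz : χ.LFunction ρ = 0) (hγ : 1 ≤ |ρ.im|) :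
    ρ.re < 1 - 1 / (9.645908801 * L) := by
  by_cases h2 : χ ^ 2 = 1
  · exact order_two_large_height hχ h1 h2 hLk hL10 hz hγ
  by_cases h3 : χ ^ 3 = 1
  · exact order_three_large_height hχ h1 h3 hLk hL10 hz hγ
  by_cases h4 : χ ^ 4 = 1
  · exact order_four_large_height hχ h2 h4 hLk hL10 hz hγ
  exact generic_large_height hχ h2 h3 h4 hLk hL10 hz hγ

end Clauses

/-! ## The Riemann zeta function (principal characters), `|γ| ≥ 2` -/

set_option maxHeartbeats 800000 in
/-- **The zeros of `ζ` by McCurley's method (his Lemma 8 is Rosser–Schoenfeld's region):** for a zero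
`ρ = β + iγ` of `ζ` with `|γ| ≥ 2` and `L ≥ log|γ|`, `L ≥ log 10`: `β < 1 − 1/(R L)`, `R = 9.645908801`
(positivity (27) for the trivial character mod 1, the zero kept at `m = 1` via Lemma 7's explicit formula,
Lemma 7 uniform for `m = 2, 3, 4`, Lemma 3). [cite: McCurley1984ZFR, Lemma 8 and §4] -/
theorem zeta_large_height {L : ℝ} {ρ : ℂ} (hLγ : Real.log |ρ.im| ≤ L) (hL10 : Real.log 10 ≤ L)
    (hz : riemannZeta ρ = 0) (hγ : 2 ≤ |ρ.im|) :
    ρ.re < 1 - 1 / (9.645908801 * L) := by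
  by_contra hcon
  have hβw := not_lt.1 hcon
  obtain ⟨hL0, hL, hσ, hσ', hβ0, hβh, hβ', hσm1⟩ := setup_h hL10 hβw
  set σ := 1 + rOpt / L with hσdef
  have hr : (0 : ℝ) < rOpt := by norm_num [rOpt]
  have hγ1 : 1 ≤ |ρ.im| := by linarith
  have hlogγ : 0 ≤ Real.log |ρ.im| := Real.log_nonneg hγ1
  have hβ1 : ρ.re < 1 := by
    by_contra hb
    exact riemannZeta_ne_zero_of_one_le_re (not_lt.1 hb) hz
  have hP := rosser_positivity_complex (1 : DirichletCharacter ℂ 1) hσ ρ.im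
  simp only [one_pow] at hP
  have hζ := fdiff_principal_le_sharp115 (k := 1) hσ hσ'
  have hhelp := sum_help_nonneg_h 1 hσ
  -- `m = 1`: the zero kept
  have hm1a := fAt_one_le 1 hσ ρ.im
  have hm1b := fAtZeta_le_of_zero hσ ρ.im hz hβ0 hβ1 hβh
  have hS := inv_sub_le_stF hσ.le (z := ρ) hβ0 hβ1.le
  have hpair := digammaPair_eq_gammaDiff_two (show (0:ℝ) < σ by linarith) ρ.im
  have hΓ1 := gammaDiff_two_le_uniform hσ hσ' hγ
  have e1r : (1 / ((σ : ℂ) + (ρ.im : ℝ) * I - 1)).re = (σ - 1) / ((σ - 1) ^ 2 + ρ.im ^ 2) := by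
    rw [one_div, re_inv_sub_eq σ ρ.im 1, one_re, one_im, sub_zero]
  have hσ₁ := sigmaOne_gt_1618 hσ.le
  have e2r : (1 / ((sigmaOne σ : ℂ) + (ρ.im : ℝ) * I - 1)).re =
      (sigmaOne σ - 1) / ((sigmaOne σ - 1) ^ 2 + ρ.im ^ 2) := by
    rw [one_div, re_inv_sub_eq (sigmaOne σ) ρ.im 1, one_re, one_im, sub_zero]
  have hp1 : 0 ≤ kappa * (1 / ((sigmaOne σ : ℂ) + (ρ.im : ℝ) * I - 1)).re := by
    rw [e2r]; exact mul_nonneg kappa_pos.le (div_nonneg (by linarith) (by positivity))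
  rw [e1r] at hm1b
  have hpole1 : (σ - 1) / ((σ - 1) ^ 2 + ρ.im ^ 2) ≤ 0.0375 := by
    have h := pole_large (m := 2) hσ hγ1 (by norm_num)
    have hγ2 : 4 ≤ ρ.im ^ 2 := by nlinarith [abs_nonneg ρ.im, sq_abs ρ.im]
    have : (σ - 1) / ((σ - 1) ^ 2 + ρ.im ^ 2) ≤ (σ - 1) / 4 :=
      div_le_div_of_nonneg_left (by linarith) (by norm_num) (by nlinarith [sq_nonneg (σ - 1)])
    have hrL : rOpt / L ≤ 0.15 := by rw [div_le_iff₀ hL0]; norm_num [rOpt]; linarith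
    rw [hσm1] at this ⊢; linarith
  -- principal sums over the prime factors of 1 vanish
  have hempty : ∑ p ∈ (1 : ℕ).primeFactors, (uCorr p σ + kappa * uCorr p (sigmaOne σ)) = 0 := by
    simp [Nat.primeFactors_one]
  have hempty' : ∑ p ∈ (1 : ℕ).primeFactors, (uCorr p σ - kappa * uCorr p (sigmaOne σ)) = 0 := by
    simp [Nat.primeFactors_one]
  rw [hempty] at hm1a
  rw [hempty'] at hζ
  -- `m = 2, 3, 4`
  have hm2 := fAt_principal_le_uniform 1 hσ hσ' (t := 2 * ρ.im) (by rw [abs_mul, abs_two]; linarith)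
  have hm3 := fAt_principal_le_uniform 1 hσ hσ' (t := 3 * ρ.im)
    (by rw [abs_mul, abs_of_pos (by norm_num : (0:ℝ) < 3)]; linarith)
  have hm4 := fAt_principal_le_uniform 1 hσ hσ' (t := 4 * ρ.im)
    (by rw [abs_mul, abs_of_pos (by norm_num : (0:ℝ) < 4)]; linarith)
  rw [hempty] at hm2 hm3 hm4
  have hγ0 : ρ.im ≠ 0 := fun h ↦ by rw [h, abs_zero] at hγ; linarith
  rw [log_abs_mul (by norm_num) hγ0] at hm2 hm3 hm4
  have hp2 := (pole_large (m := 2) hσ hγ1 (by norm_num))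
  have hp3 := (pole_large (m := 3) hσ hγ1 (by norm_num))
  have hp4 := (pole_large (m := 4) hσ hγ1 (by norm_num))
  have hrL : rOpt / L ≤ 0.15 := by rw [div_le_iff₀ hL0]; norm_num [rOpt]; linarith
  have hp2' : (σ - 1) / (2 : ℝ) ^ 2 ≤ 0.0375 := by rw [hσm1, div_le_iff₀ (by norm_num)]; linarith
  have hp3' : (σ - 1) / (3 : ℝ) ^ 2 ≤ 0.0167 := by rw [hσm1, div_le_iff₀ (by norm_num)]; linarith
  have hp4' : (σ - 1) / (4 : ℝ) ^ 2 ≤ 0.0094 := by rw [hσm1, div_le_iff₀ (by norm_num)]; linarith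
  obtain ⟨kl2, kl3, kl4⟩ := klog_bounds
  have hKpos := bigK_pos
  have hKL : bigK * Real.log |ρ.im| ≤ bigK * L := mul_le_mul_of_nonneg_left hLγ hKpos.le
  have a0 : (0 : ℝ) ≤ rsA0 := by norm_num [rsA0]
  have a1 : (0 : ℝ) ≤ rsA1 := by norm_num [rsA1]
  have a2 : (0 : ℝ) ≤ rsA2 := by norm_num [rsA2]
  have a3 : (0 : ℝ) ≤ rsA3 := by norm_num [rsA3]
  have a4 : (0 : ℝ) ≤ rsA4 := by norm_num [rsA4]
  have hm1 : fAt (1 : DirichletCharacter ℂ 1) σ ρ.im ≤ 0.0375 + bigK * L - 0.33 - 1 / (σ - ρ.re) := by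
    have := hm1a; have := hm1b; linarith
  have e0 := mul_le_mul_of_nonneg_left hζ a0
  have e1 := mul_le_mul_of_nonneg_left hm1 a1
  have e2 := mul_le_mul_of_nonneg_left (show fAt (1 : DirichletCharacter ℂ 1) σ (2 * ρ.im) ≤
    0.0375 + bigK * L + 0.1916 - 0.33 by linarith) a2
  have e3 := mul_le_mul_of_nonneg_left (show fAt (1 : DirichletCharacter ℂ 1) σ (3 * ρ.im) ≤
    0.0167 + bigK * L + 0.3037 - 0.33 by linarith) a3
  have e4 := mul_le_mul_of_nonneg_left (show fAt (1 : DirichletCharacter ℂ 1) σ (4 * ρ.im) ≤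
    0.0094 + bigK * L + 0.3832 - 0.33 by linarith) a4
  have hc : -(0.80 : ℝ) * rsA0 + (0.0375 - 0.33) * rsA1 + (0.0375 + 0.1916 - 0.33) * rsA2
      + (0.0167 + 0.3037 - 0.33) * rsA3 + (0.0094 + 0.3832 - 0.33) * rsA4 ≤ -15.6 := by
    norm_num [rsA0, rsA1, rsA2, rsA3, rsA4]
  have key : rsA1 * (1 / (σ - ρ.re)) ≤ rsA0 * (1 / (σ - 1))
      + bigK * (rsA1 + rsA2 + rsA3 + rsA4) * L - 15.6 := by
    linarith [e0, e1, e2, e3, e4, hP, hc]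
  have hm : rsA1 / (σ - ρ.re) ≤ rsA0 / (σ - 1) + bigK * (rsA1 + rsA2 + rsA3 + rsA4) * L - 15.6 := by
    simpa only [mul_one_div] using key
  have hc1 : (0 : ℝ) < rsA1 := by norm_num [rsA1]
  refine endgame_contra (K' := bigK * (rsA1 + rsA2 + rsA3 + rsA4)) (C := -15.6) hL0 hr (by norm_num) hc1
    (by norm_num) hβ' (by linarith) ?_ numeric_generic
  linarith

end McCurleyStechkin

end Literature.NumberTheory.LFunctions
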